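import Mathlib
import Summits.Ventures.HodgeRepro2.T5EisensteinField
import Summits.Ventures.HodgeRepro2.T5AdicCompletionMap
import Summits.Ventures.HodgeRepro2.T5AdicCompletionEmbedding

/-!
# A CONCRETE SPLIT PLACE: `ℚ(ζ₃)/ℚ` at `7` — `L_w = K_v` (T5EisensteinSplitPlace)

The fourth kind of place, completing the family (T5GaussianPlace wild, T5EisensteinPlace tame, T5EisensteinInertPlace
inert): `K = ℚ`, `L₃ = ℚ(ζ₃)`, `v = v₇` the place of `ℚ` at `7 ≡ 1 (mod 3)`, `w` ANY place of `L₃` above `v₇`.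
`X² + X + 1` HAS a root in `ℚ₇` (Hensel's lemma from the root `2` mod `7`: `F(2) = 7`, `F′(2) = 5` a unit), so `ω`
lies in the image of `K_v`, the closed (row 135) subfield `K_v ⊆ L_w` contains the dense image of `L₃ = ℚ(ω)`, and
`[L_w : K_v] = 1` (`finrank_eq_one`): the place is SPLIT — t6-p7's `PlaceKind.sp` on a concrete carrier.

No axiom beyond the standard trio; nothing of the scored record changes.
§8(d): uses an L-value-free non-vanishing device: NO.
-/

namespace Summit.Ventures.HodgeRepro2.T5EisensteinSplitPlace

open IsDedekindDomain HeightOneSpectrum NumberField Polynomial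
open Summit.Ventures.HodgeRepro2.T5EisensteinField

/-! ### The place `v₇` of `ℚ` and a root of `X² + X + 1` in `ℚ₇` -/

/-- The finite place `v₇` of `ℚ` at the prime `7`. -/
noncomputable def v₇ : HeightOneSpectrum (NumberField.RingOfIntegers ℚ) :=
  (Rat.HeightOneSpectrum.primesEquiv (R := NumberField.RingOfIntegers ℚ)).symm ⟨7, by norm_num⟩

/-- `(primesEquiv v₇ : ℕ) = 7`. -/
theorem primesEquiv_v₇_val :
    ((Rat.HeightOneSpectrum.primesEquiv (R := NumberField.RingOfIntegers ℚ) v₇ : Nat.Primes) : ℕ) = 7 := by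
  unfold v₇
  rw [Equiv.apply_symm_apply]

/-- HENSEL: `X² + X + 1` has a root in `ℤ_p` for `p = 7` (lift of the root `2` mod `7`: `F(2) = 7`, `F′(2) = 5`). -/
theorem exists_root_padicInt (p : ℕ) [hp : Fact p.Prime] (h7 : p = 7) :
    ∃ z : ℤ_[p], z ^ 2 + z + 1 = 0 := by
  subst h7
  have hF : ‖aeval (2 : ℤ_[7]) ((X : ℤ[X]) ^ 2 + X + 1)‖ <
      ‖aeval (2 : ℤ_[7]) (derivative ((X : ℤ[X]) ^ 2 + X + 1))‖ ^ 2 := by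
    have h1 : aeval (2 : ℤ_[7]) ((X : ℤ[X]) ^ 2 + X + 1) = ((7 : ℤ) : ℤ_[7]) := by
      simp only [map_add, map_pow, aeval_X, map_one]
      norm_num
    have h2 : aeval (2 : ℤ_[7]) (derivative ((X : ℤ[X]) ^ 2 + X + 1)) = ((5 : ℤ) : ℤ_[7]) := by
      simp only [derivative_X_pow, derivative_X, derivative_one, map_add, map_mul, map_pow, aeval_X, map_one,
        map_zero, map_natCast]
      norm_num
    rw [h1, h2]
    have h7 : ‖((7 : ℤ) : ℤ_[7])‖ < 1 := by
      rw [PadicInt.norm_int_lt_one_iff_dvd]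
      norm_num
    have h5 : ‖((5 : ℤ) : ℤ_[7])‖ = 1 := by
      apply le_antisymm (PadicInt.norm_le_one _)
      by_contra hlt
      have := (PadicInt.norm_int_lt_one_iff_dvd (p := 7) 5).mp (lt_of_not_ge hlt)
      norm_num at this
    rw [h5]
    linarith
  obtain ⟨z, hz, -⟩ := hensels_lemma hF
  refine ⟨z, ?_⟩
  simpa only [map_add, map_pow, aeval_X, map_one] using hz

/-- `X² + X + 1` has a root in `ℚ_{v₇}`. -/
theorem exists_root : ∃ y : v₇.adicCompletion ℚ, y ^ 2 + y + 1 = 0 := by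
  haveI : Fact (Nat.Prime ((Rat.HeightOneSpectrum.primesEquiv (R := NumberField.RingOfIntegers ℚ) v₇ :
      Nat.Primes) : ℕ)) := ⟨(Rat.HeightOneSpectrum.primesEquiv v₇).2⟩
  obtain ⟨z, hz⟩ := exists_root_padicInt _ primesEquiv_v₇_val
  obtain ⟨y, hy⟩ := EquivLike.surjective (Rat.HeightOneSpectrum.adicCompletion.padicEquiv v₇) (z : ℚ_[_])
  refine ⟨y, ?_⟩
  apply EquivLike.injective (Rat.HeightOneSpectrum.adicCompletion.padicEquiv v₇)
  rw [map_add, map_add, map_pow, map_one, map_zero, hy]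
  have h0 := congrArg Subtype.val hz
  push_cast at h0
  exact h0

/-! ### Every place `w ∣ 7` of `ℚ(ζ₃)` is split -/

variable (w : HeightOneSpectrum (NumberField.RingOfIntegers L₃)) [w.asIdeal.LiesOver v₇.asIdeal]

omit [w.asIdeal.LiesOver v₇.asIdeal] in
/-- The image of `ω` in `L_w` satisfies `x² + x + 1 = 0`. -/
theorem omega_completion_root :
    (algebraMap L₃ (w.adicCompletion L₃) ω) ^ 2 + algebraMap L₃ (w.adicCompletion L₃) ω + 1 = 0 := by
  rw [← map_one (algebraMap L₃ (w.adicCompletion L₃)), ← map_pow, ← map_add, ← map_add,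
    omega_sq_add_omega_add_one, map_zero]

/-- The image of `ω` IS in the image of `K_v`: the two roots of `X² + X + 1` in `L_w` are `ω` and `−1 − ω`, and one of
them comes from `K_v`. -/
theorem omega_mem_range :
    algebraMap L₃ (w.adicCompletion L₃) ω ∈
      Set.range (algebraMap (v₇.adicCompletion ℚ) (w.adicCompletion L₃)) := by
  obtain ⟨y, hy⟩ := exists_root
  have hyw : (algebraMap (v₇.adicCompletion ℚ) (w.adicCompletion L₃) y) ^ 2 +
      algebraMap (v₇.adicCompletion ℚ) (w.adicCompletion L₃) y + 1 = 0 := by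
    rw [← map_one (algebraMap (v₇.adicCompletion ℚ) (w.adicCompletion L₃)), ← map_pow, ← map_add, ← map_add, hy,
      map_zero]
  have h0 := omega_completion_root w
  have hprod : (algebraMap (v₇.adicCompletion ℚ) (w.adicCompletion L₃) y - algebraMap L₃ (w.adicCompletion L₃) ω) *
      (algebraMap (v₇.adicCompletion ℚ) (w.adicCompletion L₃) y + algebraMap L₃ (w.adicCompletion L₃) ω + 1) = 0 := by
    linear_combination hyw - h0
  rcases mul_eq_zero.mp hprod with h | h
  · exact ⟨y, (sub_eq_zero.mp h)⟩
  · refine ⟨-1 - y, ?_⟩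
    rw [map_sub, map_neg, map_one]
    linear_combination -h

/-- The image of `L₃` lies in the (closed) image of `K_v`: `L₃ = ℚ[ω]` and both `ℚ` and `ω` map into it. -/
theorem algebraMap_mem_range (x : L₃) :
    algebraMap L₃ (w.adicCompletion L₃) x ∈
      Set.range (algebraMap (v₇.adicCompletion ℚ) (w.adicCompletion L₃)) := by
  haveI := isCyclotomic
  have htop : Algebra.adjoin ℚ {ω} = ⊤ := IsCyclotomicExtension.adjoin_primitive_root_eq_top isPrimitiveRoot_omega
  have hx : x ∈ Algebra.adjoin ℚ {ω} := by rw [htop]; exact Algebra.mem_top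
  refine Algebra.adjoin_induction (p := fun x _ => algebraMap L₃ (w.adicCompletion L₃) x ∈
      Set.range (algebraMap (v₇.adicCompletion ℚ) (w.adicCompletion L₃))) ?_ ?_ ?_ ?_ hx
  · intro z hz
    rw [Set.mem_singleton_iff] at hz
    rw [hz]
    exact omega_mem_range w
  · intro q
    refine ⟨algebraMap ℚ (v₇.adicCompletion ℚ) q, ?_⟩
    rw [← IsScalarTower.algebraMap_apply]
    exact (map_ratCast _ q).trans (map_ratCast _ q).symm
  · rintro a b - - ⟨a', ha⟩ ⟨b', hb⟩
    exact ⟨a' + b', by rw [map_add, map_add, ha, hb]⟩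
  · rintro a b - - ⟨a', ha⟩ ⟨b', hb⟩
    exact ⟨a' * b', by rw [map_mul, map_mul, ha, hb]⟩

/-- `K_v = L_w`: the image of `K_v` is closed and contains the dense image of `L₃`. -/
theorem range_algebraMap_eq_univ :
    Set.range (algebraMap (v₇.adicCompletion ℚ) (w.adicCompletion L₃)) = Set.univ := by
  have hcl := Summit.Ventures.HodgeRepro2.T5AdicCompletionEmbedding.isClosed_range_algebraMap v₇ w
  have hsub : Set.range (algebraMap L₃ (w.adicCompletion L₃)) ⊆
      Set.range (algebraMap (v₇.adicCompletion ℚ) (w.adicCompletion L₃)) := by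
    rintro _ ⟨x, rfl⟩
    exact algebraMap_mem_range w x
  have hd : Dense (Set.range (algebraMap (v₇.adicCompletion ℚ) (w.adicCompletion L₃))) :=
    (IsDedekindDomain.HeightOneSpectrum.denseRange_algebraMap L₃ w).mono hsub
  rw [← hcl.closure_eq]
  exact hd.closure_eq

/-- `[L_w : K_v] = 1`: the place is SPLIT. -/
theorem finrank_eq_one : Module.finrank (v₇.adicCompletion ℚ) (w.adicCompletion L₃) = 1 := by
  rw [← IntermediateField.finrank_top', IntermediateField.finrank_eq_one_iff]
  apply eq_bot_iff.mpr
  intro x _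
  rw [IntermediateField.mem_bot, range_algebraMap_eq_univ]
  exact Set.mem_univ x

/-- Some place `w` of `ℚ(ζ₃)` lies over `v₇`. -/
theorem exists_liesOver : ∃ w : HeightOneSpectrum (NumberField.RingOfIntegers L₃), w.asIdeal.LiesOver v₇.asIdeal := by
  haveI : v₇.asIdeal.IsMaximal := v₇.isMaximal
  obtain ⟨Q, hQmax, hQ⟩ := Ideal.exists_ideal_over_maximal_of_isIntegral
    (S := NumberField.RingOfIntegers L₃) v₇.asIdeal
    (by
      rw [(RingHom.injective_iff_ker_eq_bot (algebraMap (NumberField.RingOfIntegers ℚ)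
        (NumberField.RingOfIntegers L₃))).mp (FaithfulSMul.algebraMap_injective _ _)]
      exact bot_le)
  haveI := hQmax
  refine ⟨⟨Q, hQmax.isPrime, ?_⟩, ⟨?_⟩⟩
  · rintro rfl
    rw [Ideal.comap_bot_of_injective _ (FaithfulSMul.algebraMap_injective _ _)] at hQ
    exact v₇.ne_bot hQ.symm
  · exact hQ.symm

end Summit.Ventures.HodgeRepro2.T5EisensteinSplitPlace
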